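import Summits.Ventures.PercRepro.RankLevelSetLevelNineArithMult4ZA
import Summits.Ventures.PercRepro.RankLevelSetLevelNineArithMult4ZB

/-!
# PercRepro — THE LEVEL-`9` ARITHMETIC, CAP + LEMMA T + MULTIPLICITY + LEMMA T4, PART Z: `level_9_poly_mult4` (p9, S4)

`proofs/SUBCLAIM-S4-p9.md` §S4.1 (f): the level-`9` polynomial inequalities `(P_d)`, in `ℚ`, for night-1's SPLIT fibre count with p8's NULLITY CAP (`f = min 351 (9 + d)`, `f′ = min 175 (8 + d)`; `f(9) ≤ 351` one cover step from `f(8) ≤ 175`), p2's LEMMA T (`s₃ ≤ d(d + 1)/2`), p2's LEMMA T4 (`s₄ ≤ d(d + 1)(d + 2)/3`) and night-1's MULTIPLICITY weights (`σ = Σ_j C(·, j)/(j + 1)`): `(P_d)` for every `10 ≤ d ≤ 361` at its least coefficient-positive threshold (maximum `3791` at `d = 342`; `3790` fails there) — the level-7 / level-8 recipe (`P(7) = 650`, `P(8) = 1588`) at level `9`; exact-integer thresholds work/checks/thresholds_q.py. Generated by lean-drafts/p9/g3/checks/gen_arith_mult4_q9.py 9 (p9 g3). The powers `2^F` with `F >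 256` are evaluated by the kernel (`rfl` on `ℕ`, cast to `ℚ`); `exponentiation.threshold` is raised so that `norm_cast` / `simp` do not warn on them.
Axioms: standard.
-/

set_option exponentiation.threshold 1024

namespace PercRepro

/-- **`(P_d)` at level `9`, split count with the nullity cap, Lemma T, the multiplicity weights and Lemma T4, every corank
`10 ≤ d ≤ 361`, every `p ≥ 3791`.** -/
theorem level_9_poly_mult4 (d : ℕ) (hd1 : 10 ≤ d) (hd2 : d ≤ 361) (p : ℕ) (hp : 3791 ≤ p) :
    8 * ((((p + d).choose 9 : ℕ) : ℚ) +
      (∑ j ∈ Finset.range (d - 10 + 1), ((Nat.choose (min 175 (8 + d) - 9) j : ℕ) : ℚ) / ((j : ℚ) + 1)) *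
      (((d * (d + 1) / 2 : ℕ) : ℚ) * ((p + d).choose 7 : ℚ) + ((d * (d + 1) * (d + 2) / 3 : ℕ) : ℚ) * ((p + d).choose 6 : ℚ) + (((d + 4).choose 5 : ℕ) : ℚ) * ((p + d).choose 5 : ℚ) + (((d + 5).choose 6 : ℕ) : ℚ) * ((p + d).choose 4 : ℚ) + (((d + 6).choose 7 : ℕ) : ℚ) * ((p + d).choose 3 : ℚ) + (((d + 7).choose 8 : ℕ) : ℚ) * ((p + d).choose 2 : ℚ) + (((d + 8).choose 9 : ℕ) : ℚ) * (p + d : ℚ) + (((d + 9).choose 10 : ℕ) : ℚ)) +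
      (∑ j ∈ Finset.range (d - 10 + 1), ((Nat.choose (min 351 (9 + d) - 10) j : ℕ) : ℚ) / ((j : ℚ) + 1)) *
      (((d * (d + 1) / 2 : ℕ) : ℚ) * ((10 * d).choose 7 : ℚ) + ((d * (d + 1) * (d + 2) / 3 : ℕ) : ℚ) * ((10 * d).choose 6 : ℚ) + (((d + 4).choose 5 : ℕ) : ℚ) * ((10 * d).choose 5 : ℚ) + (((d + 5).choose 6 : ℕ) : ℚ) * ((10 * d).choose 4 : ℚ) + (((d + 6).choose 7 : ℕ) : ℚ) * ((10 * d).choose 3 : ℚ) + (((d + 7).choose 8 : ℕ) : ℚ) * ((10 * d).choose 2 : ℚ) + (((d + 8).choose 9 : ℕ) : ℚ) * (10 * d : ℚ) + (((d + 9).choose 10 : ℕ) : ℚ))) ≤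
      7 * 2 ^ (d - 9) * (((p + 9).choose 9 : ℕ) : ℚ) := by
  rcases Nat.lt_or_ge d (185 + 1) with h | h
  · exact level_9_poly_mult4_ZA d hd1 (by omega) p hp
  · exact level_9_poly_mult4_ZB d (by omega) hd2 p hp

end PercRepro
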